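import Literature.Geometry.Riemannian.RicciDeTurckChartFamily
import Literature.Geometry.Lorentzian.ChartMetricCoord
import Literature.Geometry.Lorentzian.CoordEnergyEstimate
import HarnessLib

/-!
# The energy density of two Ricci flows read in two charts: pointwise comparison

Manifold-side support for the energy proof of the uniqueness of the Ricci flow on closed
manifolds (Kotschwar 2014, Thm. 1 via Prop. 7; the classical result of Hamilton 1982): the
energy is assembled from chart energies `∫ ρ̂² e dμ`, `e = Σ H² + Σ A² + Σ P²` the energy density
of the components of the two flows in a chart (`CoordEnergyEstimate.lean`), and to close
Grönwall's inequality the energy density read in one chart has to be controlled by the energy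
density read in any other chart at the same point of the manifold. This file proves that
control. For two smooth metrics `g, g'` on `TM`, a chart centre `z` and the representatives
`chartRep I g z`, `chartRep I g' z` (`RicciDeTurckChartFamily.lean`):

* the three groups of components are **frame components of intrinsic tensors**:
  `H = g − g'` evaluated on the frame `e_z.symmL` of the trivialization of `TM` at `z`
  (`chartRep_apply_symmL`, by definition), `P = Ric(g) − Ric(g')` likewise
  (`ricAt_chartRep_apply`: naturality of the Ricci tensor, `ricci_comap_apply`, and
  `OpensChart.ricci_eq_ricAt`), and `A = Γ − Γ'` is the frame reading of the difference tensor
  `∇^g − ∇^{g'}` of the Levi-Civita connections (`symmL_chrDiff_chartRep`: the Christoffel maps of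
  the chart are the Levi-Civita connections of the pulled-back metrics on constant fields,
  `OpensChart.leviCivita_const_apply`, `christoffel_eq_chrAt`, and naturality of the difference
  tensor, `difference_comap_apply`);
* hence under a change of chart the components transform with the transition matrix of the
  frames (`coordChangeL` of the trivializations) and its inverse (`hComp_chartRep_eq`,
  `pComp_chartRep_eq`, `aComp_chartRep_eq`), and by elementary estimates in a basis
  (`sum_sq_bilin_frame_le`, `sum_sq_vec_frame_le`) **the energy density read at `z` is bounded by
  a multiple of the energy density read at `z'`** (`eDens_chartRep_le`), with a factor depending
  continuously on the point through the transition matrices — uniformly on compact subsets of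
  the common chart domain (`exists_eDens_chartRep_le`).

Everything is proved; no definition is introduced (in particular none of `Prop` type).

## References

* B. Kotschwar, *An energy approach to the problem of uniqueness for the Ricci flow*,
  Comm. Anal. Geom. 22 (2014) 149–176, §2 (the energy `ℰ = ∫ |h|² + |A|² + |S|²` is intrinsic).
  [Kotschwar2014]
* B. O'Neill, *Semi-Riemannian geometry*, 1983, Ch. 3, Prop. 3.59 (naturality under local
  isometries). [ONeill1983]
-/

noncomputable section

set_option maxSynthPendingDepth 3

open Bundle Set Function Filter Module TopologicalSpace ContinuousLinearMap
open scoped Manifold ContDiff Topology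

namespace Literature.Geometry.Riemannian

open Lorentzian Lorentzian.PseudoRiemannianMetric Lorentzian.MetricCoord

/-! ### Frame algebra in a basis -/

section FrameAlgebra

variable {E : Type*} [NormedAddCommGroup E] [NormedSpace ℝ E] [FiniteDimensional ℝ E]
  {ι : Type*} [Fintype ι] (b : Basis ι ℝ E) {Nb : ℝ}

omit [Fintype ι] in
/-- `|bᵃ(c v)| ≤ ‖bᵃ‖ ‖c‖ ‖v‖`. [folklore] -/
theorem abs_coord_clm_apply_le (c : E →L[ℝ] E) (a : ι) (v : E) :
    |b.coord a (c v)| ≤ ‖coordCLM b a‖ * (‖c‖ * ‖v‖) := by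
  rw [← coordCLM_apply, ← Real.norm_eq_abs]
  exact (le_opNorm _ _).trans (mul_le_mul_of_nonneg_left (le_opNorm _ _) (norm_nonneg _))

omit [Fintype ι] in
/-- `|bᵃ(c b_m)| ≤ N_b² ‖c‖` if `‖b_i‖, ‖bⁱ‖ ≤ N_b`. [folklore] -/
theorem abs_coord_clm_basis_le (hNb : ∀ i, ‖b i‖ ≤ Nb) (hNb' : ∀ i, ‖coordCLM b i‖ ≤ Nb)
    (hN0 : 0 ≤ Nb) (c : E →L[ℝ] E) (a m : ι) : |b.coord a (c (b m))| ≤ Nb ^ 2 * ‖c‖ :=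
  calc |b.coord a (c (b m))| ≤ ‖coordCLM b a‖ * (‖c‖ * ‖b m‖) := abs_coord_clm_apply_le b c a (b m)
    _ ≤ Nb * (‖c‖ * Nb) := by gcongr; exacts [hNb' a, hNb m]
    _ = Nb ^ 2 * ‖c‖ := by ring

omit [FiniteDimensional ℝ E] in
/-- Expansion of a bilinear form on transformed basis vectors:
`B(c b_k, c b_l) = Σ_{a,d} bᵃ(c b_k) bᵈ(c b_l) B(b_a, b_d)`. [folklore] -/
theorem bilin_frame_expand (B : E →L[ℝ] E →L[ℝ] ℝ) (c : E →L[ℝ] E) (k l : ι) :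
    B (c (b k)) (c (b l)) = ∑ a, ∑ d, b.coord a (c (b k)) * b.coord d (c (b l)) * B (b a) (b d) := by
  have h1 : B (c (b k)) = ∑ a, b.coord a (c (b k)) • B (b a) := by
    conv_lhs => rw [← b.sum_repr (c (b k))]
    simp only [map_sum, map_smul, Basis.coord_apply]
  rw [h1, _root_.sum_apply]
  refine Finset.sum_congr rfl fun a _ ↦ ?_
  rw [_root_.smul_apply]
  conv_lhs => rw [← b.sum_repr (c (b l))]
  simp only [map_sum, map_smul, smul_eq_mul, Finset.mul_sum, Basis.coord_apply]
  exact Finset.sum_congr rfl fun d _ ↦ by ring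

/-- `|B(c b_k, c b_l)| ≤ (N_b² ‖c‖)² Σ_{a,d} |B(b_a, b_d)|`. [folklore] -/
theorem abs_bilin_frame_le (hNb : ∀ i, ‖b i‖ ≤ Nb) (hNb' : ∀ i, ‖coordCLM b i‖ ≤ Nb) (hN0 : 0 ≤ Nb)
    (B : E →L[ℝ] E →L[ℝ] ℝ) (c : E →L[ℝ] E) (k l : ι) :
    |B (c (b k)) (c (b l))| ≤ (Nb ^ 2 * ‖c‖) ^ 2 * ∑ p : ι × ι, |B (b p.1) (b p.2)| := by
  have hco := abs_coord_clm_basis_le b hNb hNb' hN0 c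
  have hK0 : 0 ≤ Nb ^ 2 * ‖c‖ := mul_nonneg (pow_nonneg hN0 2) (norm_nonneg _)
  rw [bilin_frame_expand b B c k l, Fintype.sum_prod_type]
  calc |∑ a, ∑ d, b.coord a (c (b k)) * b.coord d (c (b l)) * B (b a) (b d)|
      ≤ ∑ a, ∑ d, |b.coord a (c (b k)) * b.coord d (c (b l)) * B (b a) (b d)| :=
        (Finset.abs_sum_le_sum_abs _ _).trans (Finset.sum_le_sum fun a _ ↦ Finset.abs_sum_le_sum_abs _ _)
    _ ≤ ∑ a, ∑ d, (Nb ^ 2 * ‖c‖) * (Nb ^ 2 * ‖c‖) * |B (b a) (b d)| := by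
        refine Finset.sum_le_sum fun a _ ↦ Finset.sum_le_sum fun d _ ↦ ?_
        rw [abs_mul, abs_mul]
        exact mul_le_mul_of_nonneg_right (mul_le_mul (hco a k) (hco d l) (abs_nonneg _) hK0) (abs_nonneg _)
    _ = (Nb ^ 2 * ‖c‖) ^ 2 * ∑ a, ∑ d, |B (b a) (b d)| := by
        rw [Finset.mul_sum]
        refine Finset.sum_congr rfl fun a _ ↦ ?_
        rw [Finset.mul_sum]
        exact Finset.sum_congr rfl fun d _ ↦ by ring

/-- **Sums of squares of transformed bilinear components**:
`Σ_{kl} B(c b_k, c b_l)² ≤ n⁴ N_b⁸ ‖c‖⁴ Σ_{ad} B(b_a, b_d)²`. [folklore] -/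
theorem sum_sq_bilin_frame_le (hNb : ∀ i, ‖b i‖ ≤ Nb) (hNb' : ∀ i, ‖coordCLM b i‖ ≤ Nb) (hN0 : 0 ≤ Nb)
    (B : E →L[ℝ] E →L[ℝ] ℝ) (c : E →L[ℝ] E) :
    ∑ p : ι × ι, (B (c (b p.1)) (c (b p.2))) ^ 2 ≤
      (Fintype.card ι : ℝ) ^ 4 * Nb ^ 8 * ‖c‖ ^ 4 * ∑ p : ι × ι, (B (b p.1) (b p.2)) ^ 2 := by
  set S := ∑ p : ι × ι, |B (b p.1) (b p.2)| with hS
  set T := ∑ p : ι × ι, (B (b p.1) (b p.2)) ^ 2 with hT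
  have hT0 : 0 ≤ T := Finset.sum_nonneg fun p _ ↦ sq_nonneg _
  have hcard : (Fintype.card (ι × ι) : ℝ) = (Fintype.card ι : ℝ) ^ 2 := by simp [Fintype.card_prod]; ring
  have hSS : S ^ 2 ≤ (Fintype.card ι : ℝ) ^ 2 * T := by
    have h := sq_sum_abs_le (fun p : ι × ι ↦ B (b p.1) (b p.2))
    rwa [hcard] at h
  have hterm : ∀ p : ι × ι, (B (c (b p.1)) (c (b p.2))) ^ 2 ≤ (Nb ^ 2 * ‖c‖) ^ 4 * S ^ 2 := by
    intro p
    have h := abs_bilin_frame_le b hNb hNb' hN0 B c p.1 p.2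
    calc (B (c (b p.1)) (c (b p.2))) ^ 2 = |B (c (b p.1)) (c (b p.2))| ^ 2 := (sq_abs _).symm
      _ ≤ ((Nb ^ 2 * ‖c‖) ^ 2 * S) ^ 2 := pow_le_pow_left₀ (abs_nonneg _) h 2
      _ = (Nb ^ 2 * ‖c‖) ^ 4 * S ^ 2 := by ring
  calc ∑ p : ι × ι, (B (c (b p.1)) (c (b p.2))) ^ 2 ≤ ∑ _p : ι × ι, (Nb ^ 2 * ‖c‖) ^ 4 * S ^ 2 :=
        Finset.sum_le_sum fun p _ ↦ hterm p
    _ = (Fintype.card ι : ℝ) ^ 2 * ((Nb ^ 2 * ‖c‖) ^ 4 * S ^ 2) := by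
        rw [Finset.sum_const, Finset.card_univ, nsmul_eq_mul, hcard]
    _ ≤ (Fintype.card ι : ℝ) ^ 2 * ((Nb ^ 2 * ‖c‖) ^ 4 * ((Fintype.card ι : ℝ) ^ 2 * T)) := by gcongr
    _ = (Fintype.card ι : ℝ) ^ 4 * Nb ^ 8 * ‖c‖ ^ 4 * T := by ring

omit [FiniteDimensional ℝ E] in
/-- Expansion of the coordinates of a transformed vector-valued bilinear map:
`bᵐ(c'(A(c b_k, c b_l))) = Σ_{a,d,f} bᵃ(c b_k) bᵈ(c b_l) bᶠ(A(b_a,b_d)) bᵐ(c' b_f)`. [folklore] -/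
theorem vec_frame_expand (A : E →L[ℝ] E →L[ℝ] E) (c c' : E →L[ℝ] E) (k l m : ι) :
    b.coord m (c' (A (c (b k)) (c (b l)))) = ∑ a, ∑ d, ∑ f,
      b.coord a (c (b k)) * b.coord d (c (b l)) * b.coord f (A (b a) (b d)) * b.coord m (c' (b f)) := by
  -- expand the first slot
  have h1 : A (c (b k)) = ∑ a, b.coord a (c (b k)) • A (b a) := by
    conv_lhs => rw [← b.sum_repr (c (b k))]
    simp only [map_sum, map_smul, Basis.coord_apply]
  rw [h1, _root_.sum_apply, map_sum, map_sum]
  refine Finset.sum_congr rfl fun a _ ↦ ?_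
  rw [_root_.smul_apply, map_smul, map_smul, smul_eq_mul]
  -- expand the second slot
  have h2 : A (b a) (c (b l)) = ∑ d, b.coord d (c (b l)) • A (b a) (b d) := by
    conv_lhs => rw [← b.sum_repr (c (b l))]
    simp only [map_sum, map_smul, Basis.coord_apply]
  rw [h2, map_sum, map_sum, Finset.mul_sum]
  refine Finset.sum_congr rfl fun d _ ↦ ?_
  rw [map_smul, map_smul, smul_eq_mul]
  -- expand the vector `A(b_a, b_d)`
  have h3 : c' (A (b a) (b d)) = ∑ f, b.coord f (A (b a) (b d)) • c' (b f) := by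
    conv_lhs => rw [← b.sum_repr (A (b a) (b d))]
    simp only [map_sum, map_smul, Basis.coord_apply]
  rw [h3, map_sum, Finset.mul_sum, Finset.mul_sum]
  refine Finset.sum_congr rfl fun f _ ↦ ?_
  rw [map_smul, smul_eq_mul]
  ring

/-- `|bᵐ(c'(A(c b_k, c b_l)))| ≤ (N_b²‖c‖)² (N_b²‖c'‖) Σ_t |bᶠ(A(b_a, b_d))|`. [folklore] -/
theorem abs_vec_frame_le (hNb : ∀ i, ‖b i‖ ≤ Nb) (hNb' : ∀ i, ‖coordCLM b i‖ ≤ Nb) (hN0 : 0 ≤ Nb)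
    (A : E →L[ℝ] E →L[ℝ] E) (c c' : E →L[ℝ] E) (k l m : ι) :
    |b.coord m (c' (A (c (b k)) (c (b l))))| ≤ (Nb ^ 2 * ‖c‖) ^ 2 * (Nb ^ 2 * ‖c'‖) *
      ∑ t : ι × ι × ι, |b.coord t.2.2 (A (b t.1) (b t.2.1))| := by
  have hco := abs_coord_clm_basis_le b hNb hNb' hN0
  have hK0 : 0 ≤ Nb ^ 2 * ‖c‖ := mul_nonneg (pow_nonneg hN0 2) (norm_nonneg _)
  have hK0' : 0 ≤ Nb ^ 2 * ‖c'‖ := mul_nonneg (pow_nonneg hN0 2) (norm_nonneg _)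
  have hsum : ∑ t : ι × ι × ι, |b.coord t.2.2 (A (b t.1) (b t.2.1))| =
      ∑ a, ∑ d, ∑ f, |b.coord f (A (b a) (b d))| := by
    simp only [Fintype.sum_prod_type]
  rw [vec_frame_expand b A c c' k l m, hsum]
  calc |∑ a, ∑ d, ∑ f, b.coord a (c (b k)) * b.coord d (c (b l)) * b.coord f (A (b a) (b d)) * b.coord m (c' (b f))|
      ≤ ∑ a, ∑ d, ∑ f, |b.coord a (c (b k)) * b.coord d (c (b l)) * b.coord f (A (b a) (b d)) * b.coord m (c' (b f))| :=
        (Finset.abs_sum_le_sum_abs _ _).trans (Finset.sum_le_sum fun a _ ↦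
          (Finset.abs_sum_le_sum_abs _ _).trans (Finset.sum_le_sum fun d _ ↦ Finset.abs_sum_le_sum_abs _ _))
    _ ≤ ∑ a, ∑ d, ∑ f, (Nb ^ 2 * ‖c‖) * (Nb ^ 2 * ‖c‖) * |b.coord f (A (b a) (b d))| * (Nb ^ 2 * ‖c'‖) := by
        refine Finset.sum_le_sum fun a _ ↦ Finset.sum_le_sum fun d _ ↦ Finset.sum_le_sum fun f _ ↦ ?_
        rw [abs_mul, abs_mul, abs_mul]
        refine mul_le_mul ?_ (hco c' m f) (abs_nonneg _) (by positivity)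
        exact mul_le_mul_of_nonneg_right (mul_le_mul (hco c a k) (hco c d l) (abs_nonneg _) hK0) (abs_nonneg _)
    _ = (Nb ^ 2 * ‖c‖) ^ 2 * (Nb ^ 2 * ‖c'‖) * ∑ a, ∑ d, ∑ f, |b.coord f (A (b a) (b d))| := by
        simp only [Finset.mul_sum]
        exact Finset.sum_congr rfl fun a _ ↦ Finset.sum_congr rfl fun d _ ↦
          Finset.sum_congr rfl fun f _ ↦ by ring

/-- **Sums of squares of transformed vector-valued bilinear components**:
`Σ_{klm} bᵐ(c'(A(c b_k, c b_l)))² ≤ n⁶ N_b¹² ‖c‖⁴ ‖c'‖² Σ_{adf} bᶠ(A(b_a, b_d))²`. [folklore] -/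
theorem sum_sq_vec_frame_le (hNb : ∀ i, ‖b i‖ ≤ Nb) (hNb' : ∀ i, ‖coordCLM b i‖ ≤ Nb) (hN0 : 0 ≤ Nb)
    (A : E →L[ℝ] E →L[ℝ] E) (c c' : E →L[ℝ] E) :
    ∑ t : ι × ι × ι, (b.coord t.2.2 (c' (A (c (b t.1)) (c (b t.2.1))))) ^ 2 ≤
      (Fintype.card ι : ℝ) ^ 6 * Nb ^ 12 * ‖c‖ ^ 4 * ‖c'‖ ^ 2 *
        ∑ t : ι × ι × ι, (b.coord t.2.2 (A (b t.1) (b t.2.1))) ^ 2 := by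
  set S := ∑ t : ι × ι × ι, |b.coord t.2.2 (A (b t.1) (b t.2.1))| with hS
  set T := ∑ t : ι × ι × ι, (b.coord t.2.2 (A (b t.1) (b t.2.1))) ^ 2 with hT
  have hT0 : 0 ≤ T := Finset.sum_nonneg fun p _ ↦ sq_nonneg _
  have hcard : (Fintype.card (ι × ι × ι) : ℝ) = (Fintype.card ι : ℝ) ^ 3 := by simp [Fintype.card_prod]; ring
  have hSS : S ^ 2 ≤ (Fintype.card ι : ℝ) ^ 3 * T := by
    have h := sq_sum_abs_le (fun t : ι × ι × ι ↦ b.coord t.2.2 (A (b t.1) (b t.2.1)))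
    rwa [hcard] at h
  set K := (Nb ^ 2 * ‖c‖) ^ 2 * (Nb ^ 2 * ‖c'‖) with hK
  have hK0 : 0 ≤ K := by positivity
  have hterm : ∀ t : ι × ι × ι, (b.coord t.2.2 (c' (A (c (b t.1)) (c (b t.2.1))))) ^ 2 ≤ K ^ 2 * S ^ 2 := by
    intro t
    have h := abs_vec_frame_le b hNb hNb' hN0 A c c' t.1 t.2.1 t.2.2
    calc _ = |b.coord t.2.2 (c' (A (c (b t.1)) (c (b t.2.1))))| ^ 2 := (sq_abs _).symm
      _ ≤ (K * S) ^ 2 := pow_le_pow_left₀ (abs_nonneg _) h 2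
      _ = K ^ 2 * S ^ 2 := by ring
  calc ∑ t : ι × ι × ι, (b.coord t.2.2 (c' (A (c (b t.1)) (c (b t.2.1))))) ^ 2
      ≤ ∑ _t : ι × ι × ι, K ^ 2 * S ^ 2 := Finset.sum_le_sum fun t _ ↦ hterm t
    _ = (Fintype.card ι : ℝ) ^ 3 * (K ^ 2 * S ^ 2) := by
        rw [Finset.sum_const, Finset.card_univ, nsmul_eq_mul, hcard]
    _ ≤ (Fintype.card ι : ℝ) ^ 3 * (K ^ 2 * ((Fintype.card ι : ℝ) ^ 3 * T)) := by gcongr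
    _ = (Fintype.card ι : ℝ) ^ 6 * Nb ^ 12 * ‖c‖ ^ 4 * ‖c'‖ ^ 2 * T := by rw [hK]; ring

end FrameAlgebra

/-! ### The chart components are frame components of intrinsic tensors -/

section Bridges

variable {E : Type*} [NormedAddCommGroup E] [NormedSpace ℝ E] {H : Type*} [TopologicalSpace H]
  {I : ModelWithCorners ℝ E H} [I.Boundaryless] {M : Type*} [TopologicalSpace M]
  [ChartedSpace H M] [IsManifold I ∞ M] [FiniteDimensional ℝ E] [CompleteSpace E]

omit [CompleteSpace E] [I.Boundaryless] [FiniteDimensional ℝ E] in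
/-- **`H` in a chart is `g − g'` on the frame of the trivialization**: by definition,
`chartRep I g z t y (v, w) = g_t(x)(e_z.symmL x v, e_z.symmL x w)` with `x = (extChartAt I z)⁻¹ y`.
[folklore] -/
theorem chartRep_apply_symmL (g : ℝ → PseudoRiemannianMetric I ∞ E (TangentSpace I : M → Type _))
    (z : M) (t : ℝ) (y : E) (v w : E) :
    chartRep I g z t y v w = (g t).val ((extChartAt I z).symm y)
      ((trivializationAt E (TangentSpace I : M → Type _) z).symmL ℝ ((extChartAt I z).symm y) v)
      ((trivializationAt E (TangentSpace I : M → Type _) z).symmL ℝ ((extChartAt I z).symm y) w) :=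
  rfl

/-- **`P` in a chart is `Ric(g)` on the frame**: for `y` in the chart target,
`Ric(chartRep I g z t)(y)(v, w) = Ric(g_t)(x)(e_z.symmL x v, e_z.symmL x w)` (naturality of the
Ricci tensor along the inverse chart and `OpensChart.ricci_eq_ricAt`).
[cite: ONeill1983, Ch. 3, Prop. 3.59] -/
theorem ricAt_chartRep_apply (g : ℝ → PseudoRiemannianMetric I ∞ E (TangentSpace I : M → Type _))
    (z : M) (t : ℝ) [(g t).HasLeviCivita] {y : E} (hy : y ∈ (extChartAt I z).target) (v w : E) :
    ricAt (chartRep I g z t) y v w = (g t).ricci ((extChartAt I z).symm y)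
      ((trivializationAt E (TangentSpace I : M → Type _) z).symmL ℝ ((extChartAt I z).symm y) v)
      ((trivializationAt E (TangentSpace I : M → Type _) z).symmL ℝ ((extChartAt I z).symm y) w) := by
  haveI := (chartPullback I (g t) z).hasLeviCivita
  set u : chartTarget I z := ⟨y, hy⟩ with hu
  have h := (g t).ricci_comap_apply contMDiff_pullbackBilin_holds (contMDiff_chartInv z)
    (injective_mfderiv_chartInv z) rfl u v w
  rw [mfderiv_chartInv_eq_symmL z u v, mfderiv_chartInv_eq_symmL z u w] at h
  rw [← Lorentzian.OpensChart.ricci_eq_ricAt (val_chartPullback_eq_chartRep g z t) u v w]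
  exact h

/-- **`A` in a chart is the difference tensor of the Levi-Civita connections on the frame**: for
`y` in the chart target, `x = (extChartAt I z)⁻¹ y`,
`e_z.symmL x ((Γ − Γ')(y)(X₀, Y₀)) = (∇^{g_t} − ∇^{g'_t})(x)(e_z.symmL x Y₀)(e_z.symmL x X₀)`,
where `Γ, Γ'` are the Christoffel maps of the chart representatives (the Levi-Civita connections
of the pulled-back metrics on constant fields) and the right-hand side is Mathlib's difference
one-form of the two Levi-Civita connections of `g_t, g'_t` (value slot first).
[cite: ONeill1983, Ch. 3, Prop. 3.59] -/
theorem symmL_chrDiff_chartRep (g g' : ℝ → PseudoRiemannianMetric I ∞ E (TangentSpace I : M → Type _))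
    (z : M) (t : ℝ) [(g t).HasLeviCivita] [(g' t).HasLeviCivita] {y : E}
    (hy : y ∈ (extChartAt I z).target) (X₀ Y₀ : E) :
    (trivializationAt E (TangentSpace I : M → Type _) z).symmL ℝ ((extChartAt I z).symm y)
        (chrDiff (chartRep I g z t) (chartRep I g' z t) y X₀ Y₀) =
      (g t).leviCivita.difference (g' t).leviCivita ((extChartAt I z).symm y)
        ((trivializationAt E (TangentSpace I : M → Type _) z).symmL ℝ ((extChartAt I z).symm y) Y₀)
        ((trivializationAt E (TangentSpace I : M → Type _) z).symmL ℝ ((extChartAt I z).symm y) X₀) := by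
  haveI := (chartPullback I (g t) z).hasLeviCivita
  haveI := (chartPullback I (g' t) z).hasLeviCivita
  set u : chartTarget I z := ⟨y, hy⟩ with hu
  have hG := val_chartPullback_eq_chartRep g z t
  have hG' := val_chartPullback_eq_chartRep g' z t
  -- (1) `chrDiff` is the difference tensor of the pulled-back Levi-Civita connections
  have hσ := Lorentzian.OpensChart.mdifferentiableAt_const_section u Y₀
  have h1 : chrDiff (chartRep I g z t) (chartRep I g' z t) y X₀ Y₀ =
      (chartPullback I (g t) z).leviCivita.difference (chartPullback I (g' t) z).leviCivita u Y₀ X₀ := by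
    have hd := IsCovariantDerivativeOn.difference_apply (x := u)
      (chartPullback I (g t) z).leviCivita.isCovariantDerivativeOnUniv
      (chartPullback I (g' t) z).leviCivita.isCovariantDerivativeOnUniv
      (σ := fun y : chartTarget I z ↦ (Y₀ : TangentSpace 𝓘(ℝ, E) y)) (by trivial) hσ
    change _ = ((chartPullback I (g t) z).leviCivita.isCovariantDerivativeOnUniv.difference
      (chartPullback I (g' t) z).leviCivita.isCovariantDerivativeOnUniv u) Y₀ X₀
    rw [hd, _root_.sub_apply,
      Lorentzian.OpensChart.leviCivita_const_apply hG u (Lorentzian.OpensChart.differentiableAt_repr hG u) Y₀ X₀,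
      Lorentzian.OpensChart.leviCivita_const_apply hG' u (Lorentzian.OpensChart.differentiableAt_repr hG' u) Y₀ X₀,
      Lorentzian.OpensChart.christoffel_eq_chrAt hG u X₀ Y₀,
      Lorentzian.OpensChart.christoffel_eq_chrAt hG' u X₀ Y₀]
    rfl
  -- (2) naturality of the difference tensor along `chartInv`
  have h2 := difference_comap_apply (g t) (g' t) contMDiff_pullbackBilin_holds (contMDiff_chartInv z)
    (injective_mfderiv_chartInv z) rfl u Y₀ X₀
  have hinv : (mfderiv 𝓘(ℝ, E) I (chartInv I z) u).IsInvertible :=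
    isInvertible_mfderiv_of_injective rfl (injective_mfderiv_chartInv z u)
  have h3 := congrArg (mfderiv 𝓘(ℝ, E) I (chartInv I z) u) h2
  rw [hinv.self_apply_inverse, mfderiv_chartInv_eq_symmL z u Y₀, mfderiv_chartInv_eq_symmL z u X₀,
    ← h1, mfderiv_chartInv_eq_symmL z u] at h3
  exact h3

omit [CompleteSpace E] [I.Boundaryless] [FiniteDimensional ℝ E] in
/-- `H` in the chart at a point of the chart domain: `chartRep I g z t (φ_z x)(v, w) =
g_t(x)(e_z.symmL x v, e_z.symmL x w)`. [folklore] -/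
theorem chartRep_apply_of_mem (g : ℝ → PseudoRiemannianMetric I ∞ E (TangentSpace I : M → Type _))
    (z : M) (t : ℝ) {x : M} (hx : x ∈ (chartAt H z).source) (v w : E) :
    chartRep I g z t (extChartAt I z x) v w = (g t).val x
      ((trivializationAt E (TangentSpace I : M → Type _) z).symmL ℝ x v)
      ((trivializationAt E (TangentSpace I : M → Type _) z).symmL ℝ x w) := by
  have hxe : (extChartAt I z).symm (extChartAt I z x) = x :=
    (extChartAt I z).left_inv (by rwa [extChartAt_source])
  rw [chartRep_apply_symmL, hxe]

/-- `P` in the chart at a point of the chart domain. [cite: ONeill1983, Ch. 3, Prop. 3.59] -/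
theorem ricAt_chartRep_of_mem (g : ℝ → PseudoRiemannianMetric I ∞ E (TangentSpace I : M → Type _))
    (z : M) (t : ℝ) [(g t).HasLeviCivita] {x : M} (hx : x ∈ (chartAt H z).source) (v w : E) :
    ricAt (chartRep I g z t) (extChartAt I z x) v w = (g t).ricci x
      ((trivializationAt E (TangentSpace I : M → Type _) z).symmL ℝ x v)
      ((trivializationAt E (TangentSpace I : M → Type _) z).symmL ℝ x w) := by
  have hxe : (extChartAt I z).symm (extChartAt I z x) = x :=
    (extChartAt I z).left_inv (by rwa [extChartAt_source])
  have hy : extChartAt I z x ∈ (extChartAt I z).target :=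
    (extChartAt I z).map_source (by rwa [extChartAt_source])
  have h := ricAt_chartRep_apply g z t hy v w
  rw [hxe] at h
  exact h

/-- `A` in the chart at a point of the chart domain. [cite: ONeill1983, Ch. 3, Prop. 3.59] -/
theorem symmL_chrDiff_chartRep_of_mem (g g' : ℝ → PseudoRiemannianMetric I ∞ E (TangentSpace I : M → Type _))
    (z : M) (t : ℝ) [(g t).HasLeviCivita] [(g' t).HasLeviCivita] {x : M}
    (hx : x ∈ (chartAt H z).source) (X₀ Y₀ : E) :
    (trivializationAt E (TangentSpace I : M → Type _) z).symmL ℝ x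
        (chrDiff (chartRep I g z t) (chartRep I g' z t) (extChartAt I z x) X₀ Y₀) =
      (g t).leviCivita.difference (g' t).leviCivita x
        ((trivializationAt E (TangentSpace I : M → Type _) z).symmL ℝ x Y₀)
        ((trivializationAt E (TangentSpace I : M → Type _) z).symmL ℝ x X₀) := by
  have hxe : (extChartAt I z).symm (extChartAt I z x) = x :=
    (extChartAt I z).left_inv (by rwa [extChartAt_source])
  have hy : extChartAt I z x ∈ (extChartAt I z).target :=
    (extChartAt I z).map_source (by rwa [extChartAt_source])
  have h := symmL_chrDiff_chartRep g g' z t hy X₀ Y₀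
  rw [hxe] at h
  exact h

end Bridges

/-! ### Change of chart: the transition matrix of the frames -/

section FrameChange

variable {E : Type*} [NormedAddCommGroup E] [NormedSpace ℝ E] {H : Type*} [TopologicalSpace H]
  {I : ModelWithCorners ℝ E H} {M : Type*} [TopologicalSpace M]
  [ChartedSpace H M] [IsManifold I ∞ M]

/-- The chart domain is the base set of the trivialization of `TM` at `z`. [folklore] -/
theorem mem_trivializationAt_baseSet_of_mem_chart_source (z : M) {x : M} (hx : x ∈ (chartAt H z).source) :
    x ∈ (trivializationAt E (TangentSpace I : M → Type _) z).baseSet := by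
  simpa using hx

/-- **The frames of two trivializations differ by the transition matrix**: for `x` in both chart
domains, `e_z.symmL x v = e_{z'}.symmL x (c_x v)` with `c_x = coordChangeL e_z e_{z'} x`
(Mathlib's `coordChangeL_apply`, `symm_apply_apply_mk`). [folklore] -/
theorem symmL_eq_symmL_coordChangeL (z z' : M) {x : M} (hx : x ∈ (chartAt H z).source)
    (hx' : x ∈ (chartAt H z').source) (v : E) :
    (trivializationAt E (TangentSpace I : M → Type _) z).symmL ℝ x v =
      (trivializationAt E (TangentSpace I : M → Type _) z').symmL ℝ x
        (((trivializationAt E (TangentSpace I : M → Type _) z).coordChangeL ℝ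
          (trivializationAt E (TangentSpace I : M → Type _) z') x : E →L[ℝ] E) v) := by
  have hb : x ∈ (trivializationAt E (TangentSpace I : M → Type _) z).baseSet ∩
      (trivializationAt E (TangentSpace I : M → Type _) z').baseSet :=
    ⟨mem_trivializationAt_baseSet_of_mem_chart_source z hx, mem_trivializationAt_baseSet_of_mem_chart_source z' hx'⟩
  rw [Trivialization.symmL_apply _ hb.1, Trivialization.symmL_apply _ hb.2,
    ContinuousLinearEquiv.coe_coe, Trivialization.coordChangeL_apply _ _ hb,
    Trivialization.symm_apply_apply_mk _ hb.2]

/-- The frame `e_z.symmL x` is injective at the points of the chart domain. [folklore] -/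
theorem symmL_injective (z : M) {x : M} (hx : x ∈ (chartAt H z).source) :
    Function.Injective ((trivializationAt E (TangentSpace I : M → Type _) z).symmL ℝ x) := by
  have hb := mem_trivializationAt_baseSet_of_mem_chart_source (E := E) (I := I) z hx
  intro v w hvw
  have h := congrArg ((trivializationAt E (TangentSpace I : M → Type _) z).continuousLinearMapAt ℝ x) hvw
  rwa [Trivialization.continuousLinearMapAt_symmL _ hb, Trivialization.continuousLinearMapAt_symmL _ hb] at h

/-- `c'_x (c_x v) = v` for the two transition matrices `c = coordChangeL e_z e_{z'}`,
`c' = coordChangeL e_{z'} e_z`. [folklore] -/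
theorem coordChangeL_coordChangeL_apply (z z' : M) {x : M} (hx : x ∈ (chartAt H z).source)
    (hx' : x ∈ (chartAt H z').source) (v : E) :
    ((trivializationAt E (TangentSpace I : M → Type _) z').coordChangeL ℝ
        (trivializationAt E (TangentSpace I : M → Type _) z) x : E →L[ℝ] E)
      (((trivializationAt E (TangentSpace I : M → Type _) z).coordChangeL ℝ
        (trivializationAt E (TangentSpace I : M → Type _) z') x : E →L[ℝ] E) v) = v := by
  have hb' : x ∈ (trivializationAt E (TangentSpace I : M → Type _) z').baseSet ∩
      (trivializationAt E (TangentSpace I : M → Type _) z).baseSet :=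
    ⟨mem_trivializationAt_baseSet_of_mem_chart_source z' hx', mem_trivializationAt_baseSet_of_mem_chart_source z hx⟩
  rw [ContinuousLinearEquiv.coe_coe, ContinuousLinearEquiv.coe_coe,
    ← Trivialization.symm_coordChangeL (trivializationAt E (TangentSpace I : M → Type _) z)
      (trivializationAt E (TangentSpace I : M → Type _) z') hb']
  exact ContinuousLinearEquiv.symm_apply_apply _ _

end FrameChange

/-! ### The components in two charts and the comparison of the energy densities -/

section Comparison

variable {E : Type*} [NormedAddCommGroup E] [NormedSpace ℝ E] {H : Type*} [TopologicalSpace H]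
  {I : ModelWithCorners ℝ E H} [I.Boundaryless] {M : Type*} [TopologicalSpace M]
  [ChartedSpace H M] [IsManifold I ∞ M] [FiniteDimensional ℝ E] [CompleteSpace E]
  {ι : Type*} [Fintype ι] (b : Basis ι ℝ E)
  (g g' : ℝ → PseudoRiemannianMetric I ∞ E (TangentSpace I : M → Type _)) (z z' : M) (t : ℝ)
  {x : M} (hx : x ∈ (chartAt H z).source) (hx' : x ∈ (chartAt H z').source)
include hx hx'

omit [I.Boundaryless] [FiniteDimensional ℝ E] [CompleteSpace E] [Fintype ι] in
/-- **`H` under a change of chart**: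
`H^z_{kl}(φ_z x) = (G^{z'} − G'^{z'})(φ_{z'} x)(c b_k, c b_l)`. [folklore] -/
theorem hComp_chartRep_eq (p : ι × ι) :
    hComp b (chartRep I g z t) (chartRep I g' z t) (extChartAt I z x) p =
      (chartRep I g z' t (extChartAt I z' x) - chartRep I g' z' t (extChartAt I z' x))
        (((trivializationAt E (TangentSpace I : M → Type _) z).coordChangeL ℝ
          (trivializationAt E (TangentSpace I : M → Type _) z') x : E →L[ℝ] E) (b p.1))
        (((trivializationAt E (TangentSpace I : M → Type _) z).coordChangeL ℝ
          (trivializationAt E (TangentSpace I : M → Type _) z') x : E →L[ℝ] E) (b p.2)) := by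
  rw [hComp, _root_.sub_apply, _root_.sub_apply, _root_.sub_apply, _root_.sub_apply,
    chartRep_apply_of_mem g z t hx, chartRep_apply_of_mem g' z t hx,
    chartRep_apply_of_mem g z' t hx', chartRep_apply_of_mem g' z' t hx',
    symmL_eq_symmL_coordChangeL z z' hx hx' (b p.1), symmL_eq_symmL_coordChangeL z z' hx hx' (b p.2)]

omit [Fintype ι] in
/-- **`P` under a change of chart**:
`P^z_{kl}(φ_z x) = (Ric^{z'} − Ric'^{z'})(φ_{z'} x)(c b_k, c b_l)`. [cite: ONeill1983, Ch. 3, Prop. 3.59] -/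
theorem pComp_chartRep_eq (p : ι × ι) :
    pComp b (chartRep I g z t) (chartRep I g' z t) (extChartAt I z x) p =
      ricDiff (chartRep I g z' t) (chartRep I g' z' t) (extChartAt I z' x)
        (((trivializationAt E (TangentSpace I : M → Type _) z).coordChangeL ℝ
          (trivializationAt E (TangentSpace I : M → Type _) z') x : E →L[ℝ] E) (b p.1))
        (((trivializationAt E (TangentSpace I : M → Type _) z).coordChangeL ℝ
          (trivializationAt E (TangentSpace I : M → Type _) z') x : E →L[ℝ] E) (b p.2)) := by
  haveI := (g t).hasLeviCivita
  haveI := (g' t).hasLeviCivita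
  rw [pComp, ricDiff, ricDiff, _root_.sub_apply, _root_.sub_apply, _root_.sub_apply, _root_.sub_apply,
    ricAt_chartRep_of_mem g z t hx, ricAt_chartRep_of_mem g' z t hx,
    ricAt_chartRep_of_mem g z' t hx', ricAt_chartRep_of_mem g' z' t hx',
    symmL_eq_symmL_coordChangeL z z' hx hx' (b p.1), symmL_eq_symmL_coordChangeL z z' hx hx' (b p.2)]

omit [Fintype ι] in
/-- **`A` under a change of chart** (the difference of the Christoffel maps is a tensor):
`(Γ − Γ')^z(φ_z x)(X₀, Y₀) = c' ((Γ − Γ')^{z'}(φ_{z'} x)(c X₀, c Y₀))`, `c' = c⁻¹`.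
[cite: ONeill1983, Ch. 3, Prop. 3.59] -/
theorem chrDiff_chartRep_eq (X₀ Y₀ : E) :
    chrDiff (chartRep I g z t) (chartRep I g' z t) (extChartAt I z x) X₀ Y₀ =
      ((trivializationAt E (TangentSpace I : M → Type _) z').coordChangeL ℝ
          (trivializationAt E (TangentSpace I : M → Type _) z) x : E →L[ℝ] E)
        (chrDiff (chartRep I g z' t) (chartRep I g' z' t) (extChartAt I z' x)
          (((trivializationAt E (TangentSpace I : M → Type _) z).coordChangeL ℝ
            (trivializationAt E (TangentSpace I : M → Type _) z') x : E →L[ℝ] E) X₀)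
          (((trivializationAt E (TangentSpace I : M → Type _) z).coordChangeL ℝ
            (trivializationAt E (TangentSpace I : M → Type _) z') x : E →L[ℝ] E) Y₀)) := by
  haveI := (g t).hasLeviCivita
  haveI := (g' t).hasLeviCivita
  -- both sides, pushed to `T_x M` by the frame at `z'`
  have h1 := symmL_chrDiff_chartRep_of_mem g g' z t hx X₀ Y₀
  have h2 := symmL_chrDiff_chartRep_of_mem g g' z' t hx'
    (((trivializationAt E (TangentSpace I : M → Type _) z).coordChangeL ℝ
      (trivializationAt E (TangentSpace I : M → Type _) z') x : E →L[ℝ] E) X₀)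
    (((trivializationAt E (TangentSpace I : M → Type _) z).coordChangeL ℝ
      (trivializationAt E (TangentSpace I : M → Type _) z') x : E →L[ℝ] E) Y₀)
  rw [symmL_eq_symmL_coordChangeL z z' hx hx', symmL_eq_symmL_coordChangeL z z' hx hx' Y₀,
    symmL_eq_symmL_coordChangeL z z' hx hx' X₀] at h1
  rw [← h1] at h2
  -- injectivity of the frame and `c' ∘ c = id`
  have h3 := symmL_injective z' hx' h2
  have h4 := congrArg ((trivializationAt E (TangentSpace I : M → Type _) z').coordChangeL ℝ
    (trivializationAt E (TangentSpace I : M → Type _) z) x : E →L[ℝ] E) h3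
  rw [coordChangeL_coordChangeL_apply z z' hx hx'] at h4
  exact h4.symm

omit [Fintype ι] in
/-- `A` under a change of chart, componentwise. [cite: ONeill1983, Ch. 3, Prop. 3.59] -/
theorem aComp_chartRep_eq (τ : ι × ι × ι) :
    aComp b (chartRep I g z t) (chartRep I g' z t) (extChartAt I z x) τ =
      b.coord τ.2.2 (((trivializationAt E (TangentSpace I : M → Type _) z').coordChangeL ℝ
          (trivializationAt E (TangentSpace I : M → Type _) z) x : E →L[ℝ] E)
        (chrDiff (chartRep I g z' t) (chartRep I g' z' t) (extChartAt I z' x)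
          (((trivializationAt E (TangentSpace I : M → Type _) z).coordChangeL ℝ
            (trivializationAt E (TangentSpace I : M → Type _) z') x : E →L[ℝ] E) (b τ.1))
          (((trivializationAt E (TangentSpace I : M → Type _) z).coordChangeL ℝ
            (trivializationAt E (TangentSpace I : M → Type _) z') x : E →L[ℝ] E) (b τ.2.1)))) := by
  rw [aComp, coordCLM_apply, chrDiff_chartRep_eq g g' z z' t hx hx']

/-- **The energy density read at `z` is controlled by the energy density read at `z'`**: with
`c = coordChangeL e_z e_{z'} x`, `c' = coordChangeL e_{z'} e_z x` and `N_b ≥ 1` a bound for the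
basis and the dual basis,
`e^z(t, φ_z x) ≤ n⁶ N_b¹² ‖c‖⁴ (1 + ‖c'‖²) · e^{z'}(t, φ_{z'} x)`. [cite: Kotschwar2014, §2] -/
theorem eDens_chartRep_le [Nonempty ι] {Nb : ℝ} (hNb : ∀ i, ‖b i‖ ≤ Nb)
    (hNb' : ∀ i, ‖coordCLM b i‖ ≤ Nb) (hNb1 : 1 ≤ Nb) :
    eDens b (chartRep I g z t) (chartRep I g' z t) (extChartAt I z x) ≤
      (Fintype.card ι : ℝ) ^ 6 * Nb ^ 12 *
        ‖((trivializationAt E (TangentSpace I : M → Type _) z).coordChangeL ℝ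
          (trivializationAt E (TangentSpace I : M → Type _) z') x : E →L[ℝ] E)‖ ^ 4 *
        (1 + ‖((trivializationAt E (TangentSpace I : M → Type _) z').coordChangeL ℝ
          (trivializationAt E (TangentSpace I : M → Type _) z) x : E →L[ℝ] E)‖ ^ 2) *
      eDens b (chartRep I g z' t) (chartRep I g' z' t) (extChartAt I z' x) := by
  set e := trivializationAt E (TangentSpace I : M → Type _) z with he
  set e' := trivializationAt E (TangentSpace I : M → Type _) z' with he'
  set c : E →L[ℝ] E := (e.coordChangeL ℝ e' x : E →L[ℝ] E) with hc
  set c' : E →L[ℝ] E := (e'.coordChangeL ℝ e x : E →L[ℝ] E) with hc'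
  set n : ℝ := (Fintype.card ι : ℝ) with hn
  set G₁ := chartRep I g z' t with hG₁
  set G₂ := chartRep I g' z' t with hG₂
  set y' := extChartAt I z' x with hy'def
  have hN0 : 0 ≤ Nb := zero_le_one.trans hNb1
  have hn1 : 1 ≤ n := by rw [hn]; exact_mod_cast Fintype.card_pos
  -- the three groups of components
  have hH : ∑ p : ι × ι, hComp b (chartRep I g z t) (chartRep I g' z t) (extChartAt I z x) p ^ 2 ≤
      n ^ 4 * Nb ^ 8 * ‖c‖ ^ 4 * ∑ p : ι × ι, hComp b G₁ G₂ y' p ^ 2 := by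
    have h := sum_sq_bilin_frame_le b hNb hNb' hN0 (G₁ y' - G₂ y') c
    have heq : ∀ p : ι × ι, hComp b (chartRep I g z t) (chartRep I g' z t) (extChartAt I z x) p =
        (G₁ y' - G₂ y') (c (b p.1)) (c (b p.2)) := fun p ↦ hComp_chartRep_eq b g g' z z' t hx hx' p
    simp only [heq]
    exact h
  have hP : ∑ p : ι × ι, pComp b (chartRep I g z t) (chartRep I g' z t) (extChartAt I z x) p ^ 2 ≤
      n ^ 4 * Nb ^ 8 * ‖c‖ ^ 4 * ∑ p : ι × ι, pComp b G₁ G₂ y' p ^ 2 := by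
    have h := sum_sq_bilin_frame_le b hNb hNb' hN0 (ricDiff G₁ G₂ y') c
    have heq : ∀ p : ι × ι, pComp b (chartRep I g z t) (chartRep I g' z t) (extChartAt I z x) p =
        ricDiff G₁ G₂ y' (c (b p.1)) (c (b p.2)) := fun p ↦ pComp_chartRep_eq b g g' z z' t hx hx' p
    simp only [heq]
    exact h
  have hA : ∑ τ : ι × ι × ι, aComp b (chartRep I g z t) (chartRep I g' z t) (extChartAt I z x) τ ^ 2 ≤
      n ^ 6 * Nb ^ 12 * ‖c‖ ^ 4 * ‖c'‖ ^ 2 * ∑ τ : ι × ι × ι, aComp b G₁ G₂ y' τ ^ 2 := by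
    have h := sum_sq_vec_frame_le b hNb hNb' hN0 (chrDiff G₁ G₂ y') c c'
    have heq : ∀ τ : ι × ι × ι, aComp b (chartRep I g z t) (chartRep I g' z t) (extChartAt I z x) τ =
        b.coord τ.2.2 (c' (chrDiff G₁ G₂ y' (c (b τ.1)) (c (b τ.2.1)))) := fun τ ↦
      aComp_chartRep_eq b g g' z z' t hx hx' τ
    have heq' : ∀ τ : ι × ι × ι, aComp b G₁ G₂ y' τ = b.coord τ.2.2 (chrDiff G₁ G₂ y' (b τ.1) (b τ.2.1)) :=
      fun τ ↦ rfl
    simp only [heq, heq']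
    exact h
  -- compare the constants
  have h0H : 0 ≤ ∑ p : ι × ι, hComp b G₁ G₂ y' p ^ 2 := Finset.sum_nonneg fun p _ ↦ sq_nonneg _
  have h0A : 0 ≤ ∑ τ : ι × ι × ι, aComp b G₁ G₂ y' τ ^ 2 := Finset.sum_nonneg fun p _ ↦ sq_nonneg _
  have h0P : 0 ≤ ∑ p : ι × ι, pComp b G₁ G₂ y' p ^ 2 := Finset.sum_nonneg fun p _ ↦ sq_nonneg _
  have hc0 : 0 ≤ ‖c‖ ^ 4 := by positivity
  have hK₁ : n ^ 4 * Nb ^ 8 * ‖c‖ ^ 4 ≤ n ^ 6 * Nb ^ 12 * ‖c‖ ^ 4 * (1 + ‖c'‖ ^ 2) := by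
    have h1 : n ^ 4 ≤ n ^ 6 := pow_le_pow_right₀ hn1 (by norm_num)
    have h2 : Nb ^ 8 ≤ Nb ^ 12 := pow_le_pow_right₀ hNb1 (by norm_num)
    have h3 : (1 : ℝ) ≤ 1 + ‖c'‖ ^ 2 := le_add_of_nonneg_right (sq_nonneg _)
    calc n ^ 4 * Nb ^ 8 * ‖c‖ ^ 4 = n ^ 4 * Nb ^ 8 * ‖c‖ ^ 4 * 1 := by ring
      _ ≤ n ^ 6 * Nb ^ 12 * ‖c‖ ^ 4 * (1 + ‖c'‖ ^ 2) := by gcongr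
  have hK₂ : n ^ 6 * Nb ^ 12 * ‖c‖ ^ 4 * ‖c'‖ ^ 2 ≤ n ^ 6 * Nb ^ 12 * ‖c‖ ^ 4 * (1 + ‖c'‖ ^ 2) := by
    have : ‖c'‖ ^ 2 ≤ 1 + ‖c'‖ ^ 2 := le_add_of_nonneg_left zero_le_one
    gcongr
  unfold eDens
  calc _ ≤ n ^ 4 * Nb ^ 8 * ‖c‖ ^ 4 * ∑ p : ι × ι, hComp b G₁ G₂ y' p ^ 2
        + n ^ 6 * Nb ^ 12 * ‖c‖ ^ 4 * ‖c'‖ ^ 2 * ∑ τ : ι × ι × ι, aComp b G₁ G₂ y' τ ^ 2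
        + n ^ 4 * Nb ^ 8 * ‖c‖ ^ 4 * ∑ p : ι × ι, pComp b G₁ G₂ y' p ^ 2 := add_le_add (add_le_add hH hA) hP
    _ ≤ n ^ 6 * Nb ^ 12 * ‖c‖ ^ 4 * (1 + ‖c'‖ ^ 2) * ∑ p : ι × ι, hComp b G₁ G₂ y' p ^ 2
        + n ^ 6 * Nb ^ 12 * ‖c‖ ^ 4 * (1 + ‖c'‖ ^ 2) * ∑ τ : ι × ι × ι, aComp b G₁ G₂ y' τ ^ 2
        + n ^ 6 * Nb ^ 12 * ‖c‖ ^ 4 * (1 + ‖c'‖ ^ 2) * ∑ p : ι × ι, pComp b G₁ G₂ y' p ^ 2 :=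
          add_le_add (add_le_add (mul_le_mul_of_nonneg_right hK₁ h0H) (mul_le_mul_of_nonneg_right hK₂ h0A))
            (mul_le_mul_of_nonneg_right hK₁ h0P)
    _ = _ := by ring

omit hx hx' in
/-- **Uniform comparison on compact sets.** For a compact `K` inside both chart domains there is
`C ≥ 0` with `e^z(t, φ_z x) ≤ C · e^{z'}(t, φ_{z'} x)` for all `x ∈ K` and all times `t` (the
transition matrices are continuous on the common domain, `continuousOn_coordChange`).
[cite: Kotschwar2014, §2] -/
theorem exists_eDens_chartRep_le [Nonempty ι] {K : Set M} (hK : IsCompact K)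
    (hKz : K ⊆ (chartAt H z).source) (hKz' : K ⊆ (chartAt H z').source) :
    ∃ C : ℝ, 0 ≤ C ∧ ∀ (s : ℝ), ∀ x ∈ K,
      eDens b (chartRep I g z s) (chartRep I g' z s) (extChartAt I z x) ≤
        C * eDens b (chartRep I g z' s) (chartRep I g' z' s) (extChartAt I z' x) := by
  set e := trivializationAt E (TangentSpace I : M → Type _) z with he
  set e' := trivializationAt E (TangentSpace I : M → Type _) z' with he'
  -- a bound for the basis and the dual basis
  set Nb : ℝ := 1 + ∑ i, ‖b i‖ + ∑ i, ‖coordCLM b i‖ with hNb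
  have hs₁ : 0 ≤ ∑ i, ‖b i‖ := Finset.sum_nonneg fun i _ ↦ norm_nonneg _
  have hs₂ : 0 ≤ ∑ i, ‖coordCLM b i‖ := Finset.sum_nonneg fun i _ ↦ norm_nonneg _
  have hNb1 : 1 ≤ Nb := by rw [hNb]; linarith
  have hNbb : ∀ i, ‖b i‖ ≤ Nb := fun i ↦ by
    have := Finset.single_le_sum (f := fun i ↦ ‖b i‖) (fun _ _ ↦ norm_nonneg _) (Finset.mem_univ i)
    rw [hNb]; linarith
  have hNbc : ∀ i, ‖coordCLM b i‖ ≤ Nb := fun i ↦ by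
    have := Finset.single_le_sum (f := fun i ↦ ‖coordCLM b i‖) (fun _ _ ↦ norm_nonneg _) (Finset.mem_univ i)
    rw [hNb]; linarith
  -- bounds for the transition matrices on `K`
  have hKb : K ⊆ e.baseSet ∩ e'.baseSet := fun x hx ↦
    ⟨by simpa [he] using hKz hx, by simpa [he'] using hKz' hx⟩
  have hKb' : K ⊆ e'.baseSet ∩ e.baseSet := fun x hx ↦ ⟨(hKb hx).2, (hKb hx).1⟩
  have hcont : ContinuousOn (fun x ↦ (e.coordChangeL ℝ e' x : E →L[ℝ] E)) (e.baseSet ∩ e'.baseSet) :=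
    continuousOn_coordChange ℝ e e'
  have hcont' : ContinuousOn (fun x ↦ (e'.coordChangeL ℝ e x : E →L[ℝ] E)) (e'.baseSet ∩ e.baseSet) :=
    continuousOn_coordChange ℝ e' e
  obtain ⟨a, ha⟩ := hK.exists_bound_of_continuousOn (hcont.mono hKb)
  obtain ⟨a', ha'⟩ := hK.exists_bound_of_continuousOn (hcont'.mono hKb')
  set A := max a 0 with hA
  set A' := max a' 0 with hA'
  refine ⟨(Fintype.card ι : ℝ) ^ 6 * Nb ^ 12 * A ^ 4 * (1 + A' ^ 2), by positivity, fun s x hxK ↦ ?_⟩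
  have h := eDens_chartRep_le b g g' z z' s (hKz hxK) (hKz' hxK) hNbb hNbc hNb1
  have h1 : ‖(e.coordChangeL ℝ e' x : E →L[ℝ] E)‖ ≤ A := (ha x hxK).trans (le_max_left _ _)
  have h2 : ‖(e'.coordChangeL ℝ e x : E →L[ℝ] E)‖ ≤ A' := (ha' x hxK).trans (le_max_left _ _)
  have he0 : 0 ≤ eDens b (chartRep I g z' s) (chartRep I g' z' s) (extChartAt I z' x) := eDens_nonneg _
  refine h.trans (mul_le_mul_of_nonneg_right ?_ he0)
  have hN0 : 0 ≤ Nb := zero_le_one.trans hNb1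
  gcongr

end Comparison

end Literature.Geometry.Riemannian

end
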